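import Summits.BirchSwinnertonDyer.BirchSwinnertonDyer.Theorems.Rank2ObservatoryTorsionCertC
import HarnessLib

/-!
# Rank-2 observatory — torsion certificates: the format `TorsCert`, soundness, row walkers

HONEST FRAMING: per-curve certified theorems and census instruments; no claim on BSD in
rank ≥ 2.  This file proves nothing about `L`-functions or ranks.  It provides a kernel-checkable
certificate format `TorsCert` and its soundness theorem

  `torsionOrder_of_check : c.check V = true → #E(ℚ)_tors = c.order`

for an integral Weierstrass model `V` (`E = V/ℚ`), where `#E(ℚ)_tors` is Literature's BSD-formula
invariant `WeierstrassCurve.torsionOrder`.  The certificate kinds cover the torsion structures met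
on the rank-3 table of the observatory: trivial, `ℤ/2`, `ℤ/3`, `ℤ/4`, `ℤ/2 × ℤ/2`, and "trivial,
but 3-isogenous to a `ℤ/3`-curve" (where no good prime has `#Ẽ(𝔽_ℓ)` prime to `3`).

Ingredients (all elementary):
* the observatory's annihilator (`#Ẽ(𝔽_ℓ) • P = 0` for torsion `P`, Silverman AEC VII.3.1(b)) and
  reduction witnesses (`Rank2ObservatoryKernelWalkerT` and its imports);
* `ψ₃(x(P)) = 0` for a point `P` of order `3` (AEC III Ex. 3.7), with a rational-root test for the
  cofactor cubic and a square test, both by residues;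
* the explicit `2`-torsion of a model whose `2`-division cubic splits over `ℤ`.
Parts A–C (`Rank2ObservatoryTorsionCertA/B/C`) hold the mathematical lemmas; this file holds the
certificate format, its checker and soundness, the walker over `Rank3Row × TorsCert`, and the zip/slice
plumbing used by the census data chunks.
-/

-- single-conjunct summit: `Summit.BirchSwinnertonDyer.BirchSwinnertonDyer.…` repeats the name by design
set_option linter.dupNamespace false

namespace Summit.BirchSwinnertonDyer.BirchSwinnertonDyer.Rank2Observatory

open WeierstrassCurve Literature.NumberTheory.EllipticCurves

/-! ### The certificate format and its soundness -/

/-- TORSION CERTIFICATE for an integral model `V` (data for `decide`).  Constructors / claims: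
* `triv S` — `#E(ℚ)_tors = 1`: killers `S` with annihilator `1`;
* `isog3 S p₀ q₀ c₃ c₂ c₁ c₀ m m'` — `#E(ℚ)_tors = 1`: annihilator `3`, `ψ₃ = (q₀X − p₀)·c`, `c` without
  roots mod `m` (`gcd(c₃, m) = 1`), `threeDiscZ` a non-square mod `m'`;
* `z3 S x₀ y₀ c₃ c₂ c₁ c₀ m` — `ℤ/3`: annihilator `3`, `P₀ = (x₀, y₀)` with `2P₀ = −P₀`, `ψ₃ = (X − x₀)·c`;
* `z2 d S e xT yT ℓ₁ ℓ₂` — `ℤ/2` (on the scaled model `V_d`): annihilator `2^e`, `T = (xT, yT)`,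
  witnesses `twoTorsB ℓ₁`, `dblWitnessB ℓ₂`;
* `z4 d S e xT yT x₄ y₄ ℓ₁ ℓ₂` — `ℤ/4` (on `V_d`): `2T₄ = T` (`intTangent`), `fourTorsB ℓ₁`, `dblWitnessB ℓ₂ x₄`;
* `z22 d S e x₁ y₁ x₂ y₂ x₃ y₃ ℓ₁ ℓ₂ ℓ₃` — `ℤ/2 × ℤ/2` (on `V_d`): split `2`-torsion, `dblWitnessB ℓᵢ xᵢ`.
[cite: CremonaAlgorithms1997, §3.3] -/
inductive TorsCert where
  | triv (S : List (ℕ × ℕ))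
  | isog3 (S : List (ℕ × ℕ)) (p₀ q₀ c₃ c₂ c₁ c₀ : ℤ) (m m' : ℕ)
  | z3 (S : List (ℕ × ℕ)) (x₀ y₀ c₃ c₂ c₁ c₀ : ℤ) (m : ℕ)
  | z2 (d : ℤ) (S : List (ℕ × ℕ)) (e : ℕ) (xT yT : ℤ) (ℓ₁ ℓ₂ : ℕ)
  | z4 (d : ℤ) (S : List (ℕ × ℕ)) (e : ℕ) (xT yT x₄ y₄ : ℤ) (ℓ₁ ℓ₂ : ℕ)
  | z22 (d : ℤ) (S : List (ℕ × ℕ)) (e : ℕ) (x₁ y₁ x₂ y₂ x₃ y₃ : ℤ) (ℓ₁ ℓ₂ ℓ₃ : ℕ)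

/-- The torsion order a certificate claims. [folklore] -/
def TorsCert.order : TorsCert → ℕ
  | .triv .. => 1
  | .isog3 .. => 1
  | .z3 .. => 3
  | .z2 .. => 2
  | .z4 .. => 4
  | .z22 .. => 4

/-- The torsion structure a certificate claims, as a tag: `1` trivial, `2` = `ℤ/2`, `3` = `ℤ/3`,
`4` = `ℤ/4`, `22` = `ℤ/2 × ℤ/2`. [folklore] -/
def TorsCert.kind : TorsCert → ℕ
  | .triv .. => 1
  | .isog3 .. => 1
  | .z3 .. => 3
  | .z2 .. => 2
  | .z4 .. => 4
  | .z22 .. => 22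

/-- The CHECK of a torsion certificate against an integral model (one Boolean for `decide`).
[cite: CremonaAlgorithms1997, §3.3] [cite: SilvermanAEC2009, Prop. VII.3.1(b)] -/
def TorsCert.check (V : WeierstrassCurve ℤ) : TorsCert → Bool
  | .triv S => S.all (killerB V) && annihilatorCheck S 1
  | .isog3 S p₀ q₀ c₃ c₂ c₁ c₀ m m' =>
    S.all (killerB V) && annihilatorCheck S 3 && psi3FactorB V p₀ q₀ c₃ c₂ c₁ c₀ &&
      noRatRootB c₃ c₂ c₁ c₀ m && nonSquareB (threeDiscZ V p₀ q₀) m'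
  | .z3 S x₀ y₀ c₃ c₂ c₁ c₀ m =>
    decide (V.Δ ≠ 0) && S.all (killerB V) && annihilatorCheck S 3 && onCurveZ V x₀ y₀ &&
      intTangent V x₀ y₀ x₀ (-y₀ - V.a₁ * x₀ - V.a₃) && psi3FactorB V x₀ 1 c₃ c₂ c₁ c₀ &&
      noRatRootB c₃ c₂ c₁ c₀ m
  | .z2 d S e xT yT ℓ₁ ℓ₂ =>
    decide (d ≠ 0) && S.all (killerB (scaleModel V d)) && annihilatorCheck S (2 ^ e) &&
      onCurveZ (scaleModel V d) xT yT &&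
      decide (2 * yT + (scaleModel V d).a₁ * xT + (scaleModel V d).a₃ = 0) &&
      twoTorsB (scaleModel V d) ℓ₁ xT yT && dblWitnessB (scaleModel V d) ℓ₂ xT
  | .z4 d S e xT yT x₄ y₄ ℓ₁ ℓ₂ =>
    decide (d ≠ 0) && S.all (killerB (scaleModel V d)) && annihilatorCheck S (2 ^ e) &&
      onCurveZ (scaleModel V d) xT yT &&
      decide (2 * yT + (scaleModel V d).a₁ * xT + (scaleModel V d).a₃ = 0) &&
      onCurveZ (scaleModel V d) x₄ y₄ && intTangent (scaleModel V d) x₄ y₄ xT yT &&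
      fourTorsB (scaleModel V d) ℓ₁ xT yT x₄ y₄ && dblWitnessB (scaleModel V d) ℓ₂ x₄
  | .z22 d S e x₁ y₁ x₂ y₂ x₃ y₃ ℓ₁ ℓ₂ ℓ₃ =>
    decide (d ≠ 0) && S.all (killerB (scaleModel V d)) && annihilatorCheck S (2 ^ e) &&
      onCurveZ (scaleModel V d) x₁ y₁ && onCurveZ (scaleModel V d) x₂ y₂ &&
      onCurveZ (scaleModel V d) x₃ y₃ && twoSplitB (scaleModel V d) x₁ y₁ x₂ y₂ x₃ y₃ &&
      dblWitnessB (scaleModel V d) ℓ₁ x₁ && dblWitnessB (scaleModel V d) ℓ₂ x₂ &&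
      dblWitnessB (scaleModel V d) ℓ₃ x₃

section Soundness

variable (V : WeierstrassCurve ℤ)

/-- Soundness, kind `ℤ/2` (scaled model): order `2` and exponent `2`.
[cite: SilvermanAEC2009, Prop. VII.3.1(b)] -/
theorem torsion_of_checkZ2 {d : ℤ} {S : List (ℕ × ℕ)} {e : ℕ} {xT yT : ℤ} {ℓ₁ ℓ₂ : ℕ}
    (h : (TorsCert.z2 d S e xT yT ℓ₁ ℓ₂).check V = true) :
    d ≠ 0 ∧ ((scaleModel V d).map (Int.castRingHom ℚ)).torsionOrder = 2 ∧
      ∀ τ : ((scaleModel V d).map (Int.castRingHom ℚ)).toAffine.Point,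
        IsOfFinAddOrder τ → 2 • τ = 0 := by
  simp only [TorsCert.check, Bool.and_eq_true, decide_eq_true_eq] at h
  obtain ⟨⟨⟨⟨⟨⟨hd, hS⟩, ht⟩, hT⟩, hT2⟩, hl₁⟩, hl₂⟩ := h
  cases ℓ₁ with
  | zero => simp [twoTorsB] at hl₁
  | succ ℓ₁ =>
  cases ℓ₂ with
  | zero => simp [dblWitnessB] at hl₂
  | succ ℓ₂ =>
  simp only [twoTorsB, goodPrimeB, Bool.and_eq_true, decide_eq_true_eq] at hl₁
  simp only [dblWitnessB, goodPrimeB, Bool.and_eq_true, decide_eq_true_eq] at hl₂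
  haveI : Fact (ℓ₁ + 1).Prime := ⟨hl₁.1.1.1⟩
  haveI : Fact (ℓ₂ + 1).Prime := ⟨hl₂.1.1⟩
  exact ⟨hd, torsionOrder_eq_two_of_witness (scaleModel V d) hS ht (onCurveZ_spec _ hT) hT2
    (ℓ₁ + 1) hl₁.1.1.2 hl₁.1.2 hl₁.2 (ℓ₂ + 1) hl₂.1.2 hl₂.2⟩

/-- Soundness, kind `ℤ/4` (scaled model): order `4` and an element of order `4`.
[cite: SilvermanAEC2009, Prop. VII.3.1(b)] -/
theorem torsion_of_checkZ4 {d : ℤ} {S : List (ℕ × ℕ)} {e : ℕ} {xT yT x₄ y₄ : ℤ} {ℓ₁ ℓ₂ : ℕ}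
    (h : (TorsCert.z4 d S e xT yT x₄ y₄ ℓ₁ ℓ₂).check V = true) :
    d ≠ 0 ∧ ((scaleModel V d).map (Int.castRingHom ℚ)).torsionOrder = 4 ∧
      ∃ τ : ((scaleModel V d).map (Int.castRingHom ℚ)).toAffine.Point,
        IsOfFinAddOrder τ ∧ 2 • τ ≠ 0 := by
  simp only [TorsCert.check, Bool.and_eq_true, decide_eq_true_eq] at h
  obtain ⟨⟨⟨⟨⟨⟨⟨⟨hd, hS⟩, ht⟩, hT⟩, hT2⟩, h₄⟩, htan⟩, hl₁⟩, hl₂⟩ := h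
  cases ℓ₁ with
  | zero => simp [fourTorsB] at hl₁
  | succ ℓ₁ =>
  cases ℓ₂ with
  | zero => simp [dblWitnessB] at hl₂
  | succ ℓ₂ =>
  simp only [fourTorsB, goodPrimeB, Bool.and_eq_true, decide_eq_true_eq] at hl₁
  simp only [dblWitnessB, goodPrimeB, Bool.and_eq_true, decide_eq_true_eq] at hl₂
  haveI : Fact (ℓ₁ + 1).Prime := ⟨hl₁.1.1.1.1⟩
  haveI : Fact (ℓ₂ + 1).Prime := ⟨hl₂.1.1⟩
  exact ⟨hd, torsionOrder_eq_four_of_witness (scaleModel V d) hS ht (onCurveZ_spec _ hT) hT2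
    (onCurveZ_spec _ h₄) htan (ℓ₁ + 1) hl₁.1.1.1.2 hl₁.1.1.2 hl₁.1.2 hl₁.2 (ℓ₂ + 1) hl₂.1.2 hl₂.2⟩

/-- Soundness, kind `ℤ/2 × ℤ/2` (scaled model): order `4` and exponent `2`.
[cite: SilvermanAEC2009, Prop. VII.3.1(b)] -/
theorem torsion_of_checkZ22 {d : ℤ} {S : List (ℕ × ℕ)} {e : ℕ} {x₁ y₁ x₂ y₂ x₃ y₃ : ℤ}
    {ℓ₁ ℓ₂ ℓ₃ : ℕ} (h : (TorsCert.z22 d S e x₁ y₁ x₂ y₂ x₃ y₃ ℓ₁ ℓ₂ ℓ₃).check V = true) :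
    d ≠ 0 ∧ ((scaleModel V d).map (Int.castRingHom ℚ)).torsionOrder = 4 ∧
      ∀ τ : ((scaleModel V d).map (Int.castRingHom ℚ)).toAffine.Point,
        IsOfFinAddOrder τ → 2 • τ = 0 := by
  simp only [TorsCert.check, Bool.and_eq_true, decide_eq_true_eq] at h
  obtain ⟨⟨⟨⟨⟨⟨⟨⟨⟨hd, hS⟩, ht⟩, h₁⟩, h₂⟩, h₃⟩, hs⟩, hl₁⟩, hl₂⟩, hl₃⟩ := h
  cases ℓ₁ with
  | zero => simp [dblWitnessB] at hl₁
  | succ ℓ₁ =>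
  cases ℓ₂ with
  | zero => simp [dblWitnessB] at hl₂
  | succ ℓ₂ =>
  cases ℓ₃ with
  | zero => simp [dblWitnessB] at hl₃
  | succ ℓ₃ =>
  simp only [dblWitnessB, goodPrimeB, Bool.and_eq_true, decide_eq_true_eq] at hl₁ hl₂ hl₃
  haveI : Fact (ℓ₁ + 1).Prime := ⟨hl₁.1.1⟩
  haveI : Fact (ℓ₂ + 1).Prime := ⟨hl₂.1.1⟩
  haveI : Fact (ℓ₃ + 1).Prime := ⟨hl₃.1.1⟩
  exact ⟨hd, torsionOrder_eq_four_of_split (scaleModel V d) hS ht (onCurveZ_spec _ h₁)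
    (onCurveZ_spec _ h₂) (onCurveZ_spec _ h₃) hs (ℓ₁ + 1) hl₁.1.2 hl₁.2 (ℓ₂ + 1) hl₂.1.2 hl₂.2
    (ℓ₃ + 1) hl₃.1.2 hl₃.2⟩

/-- **SOUNDNESS OF TORSION CERTIFICATES**: a checking certificate computes `#E(ℚ)_tors`
(Literature's `torsionOrder`, the BSD-formula invariant) of `E = V/ℚ`.
[cite: SilvermanAEC2009, Prop. VII.3.1(b)] [cite: CremonaAlgorithms1997, §3.3] -/
theorem torsionOrder_of_check (c : TorsCert) (h : c.check V = true) :
    (V.map (Int.castRingHom ℚ)).torsionOrder = c.order := by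
  cases c with
  | triv S =>
    simp only [TorsCert.check, Bool.and_eq_true] at h
    exact torsionOrder_eq_one_of_killers V h.1 h.2
  | isog3 S p₀ q₀ c₃ c₂ c₁ c₀ m m' =>
    simp only [TorsCert.check, Bool.and_eq_true] at h
    obtain ⟨⟨⟨⟨hS, ht⟩, hfac⟩, hc⟩, hD⟩ := h
    exact torsionOrder_eq_one_of_isog V hS ht hfac hc hD
  | z3 S x₀ y₀ c₃ c₂ c₁ c₀ m =>
    simp only [TorsCert.check, Bool.and_eq_true, decide_eq_true_eq] at h
    obtain ⟨⟨⟨⟨⟨⟨hΔ, hS⟩, ht⟩, h₀⟩, htan⟩, hfac⟩, hc⟩ := h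
    exact torsionOrder_eq_three_of_witness V hΔ hS ht (onCurveZ_spec _ h₀) htan hfac hc
  | z2 d S e xT yT ℓ₁ ℓ₂ =>
    obtain ⟨hd, ho, -⟩ := torsion_of_checkZ2 V h
    rw [← torsionOrder_scaleModel V hd]; exact ho
  | z4 d S e xT yT x₄ y₄ ℓ₁ ℓ₂ =>
    obtain ⟨hd, ho, -⟩ := torsion_of_checkZ4 V h
    rw [← torsionOrder_scaleModel V hd]; exact ho
  | z22 d S e x₁ y₁ x₂ y₂ x₃ y₃ ℓ₁ ℓ₂ ℓ₃ =>
    obtain ⟨hd, ho, -⟩ := torsion_of_checkZ22 V h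
    rw [← torsionOrder_scaleModel V hd]; exact ho

/-- **Exponent `2`** for kinds `ℤ/2` and `ℤ/2 × ℤ/2`: every rational torsion point is killed by `2`.
[cite: SilvermanAEC2009, Prop. VII.3.1(b)] -/
theorem two_nsmul_torsion_of_check (c : TorsCert) (hk : c.kind = 2 ∨ c.kind = 22)
    (h : c.check V = true) :
    ∀ τ : (V.map (Int.castRingHom ℚ)).toAffine.Point, IsOfFinAddOrder τ → 2 • τ = 0 := by
  cases c with
  | triv => simp [TorsCert.kind] at hk
  | isog3 => simp [TorsCert.kind] at hk
  | z3 => simp [TorsCert.kind] at hk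
  | z4 => simp [TorsCert.kind] at hk
  | z2 d S e xT yT ℓ₁ ℓ₂ =>
    obtain ⟨hd, -, h2⟩ := torsion_of_checkZ2 V h
    exact torsion_two_nsmul_of_addEquiv (scalePointEquiv V hd) h2
  | z22 d S e x₁ y₁ x₂ y₂ x₃ y₃ ℓ₁ ℓ₂ ℓ₃ =>
    obtain ⟨hd, -, h2⟩ := torsion_of_checkZ22 V h
    exact torsion_two_nsmul_of_addEquiv (scalePointEquiv V hd) h2

/-- **An element of order `4`** for kind `ℤ/4`: some rational torsion point is not killed by `2`
(so, with `#E(ℚ)_tors = 4`, `E(ℚ)_tors ≅ ℤ/4`). [cite: SilvermanAEC2009, Prop. VII.3.1(b)] -/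
theorem exists_torsion_two_nsmul_ne_of_check (c : TorsCert) (hk : c.kind = 4)
    (h : c.check V = true) :
    ∃ τ : (V.map (Int.castRingHom ℚ)).toAffine.Point, IsOfFinAddOrder τ ∧ 2 • τ ≠ 0 := by
  cases c with
  | triv => simp [TorsCert.kind] at hk
  | isog3 => simp [TorsCert.kind] at hk
  | z3 => simp [TorsCert.kind] at hk
  | z2 => simp [TorsCert.kind] at hk
  | z22 => simp [TorsCert.kind] at hk
  | z4 d S e xT yT x₄ y₄ ℓ₁ ℓ₂ =>
    obtain ⟨hd, -, h4⟩ := torsion_of_checkZ4 V h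
    exact exists_torsion_two_nsmul_ne_of_addEquiv (scalePointEquiv V hd) h4

end Soundness

/-! ### Walker over table rows -/

/-- The row's curve over `ℚ` is its integer model mapped along `ℤ → ℚ`. [folklore] -/
theorem Rank3Row.curve_eq_map_intModel (r : Rank3Row) :
    r.curve = r.intModel.map (Int.castRingHom ℚ) := by
  rw [Rank3Row.curve_eq_baseChange]; rfl

/-- ROW CHECK: the torsion certificate checks on the row's integer model. [folklore] -/
def torsRowCheck (p : Rank3Row × TorsCert) : Bool :=
  p.2.check p.1.intModel

/-- **WALKER (torsion)**: if every `(row, certificate)` pair of a list checks, every listed row's curve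
has the certified torsion order `#E(ℚ)_tors`. HONEST FRAMING: per-curve certified theorems and census
instruments; no claim on BSD in rank ≥ 2. [cite: SilvermanAEC2009, Prop. VII.3.1(b)]
[cite: CremonaAlgorithms1997, §3.3] -/
theorem torsionOrder_of_all_torsRowCheck {L : List (Rank3Row × TorsCert)}
    (h : L.all torsRowCheck = true) :
    ∀ p ∈ L, p.1.curve.torsionOrder = p.2.order := by
  intro p hp
  rw [Rank3Row.curve_eq_map_intModel]
  exact torsionOrder_of_check _ _ (List.all_eq_true.mp h p hp)

/-- **WALKER (exponent `2`)**: rows certified of kind `ℤ/2` or `ℤ/2 × ℤ/2` have `2 • τ = 0` for every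
rational torsion point `τ`. [cite: SilvermanAEC2009, Prop. VII.3.1(b)] -/
theorem two_nsmul_torsion_of_all_torsRowCheck {L : List (Rank3Row × TorsCert)}
    (h : L.all torsRowCheck = true) :
    ∀ p ∈ L, (p.2.kind = 2 ∨ p.2.kind = 22) →
      ∀ τ : p.1.curve.toAffine.Point, IsOfFinAddOrder τ → 2 • τ = 0 := by
  intro p hp hk
  rw [Rank3Row.curve_eq_map_intModel]
  exact two_nsmul_torsion_of_check _ _ hk (List.all_eq_true.mp h p hp)

/-- **WALKER (order `4` element)**: rows certified of kind `ℤ/4` have a rational torsion point `τ` with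
`2 • τ ≠ 0`. [cite: SilvermanAEC2009, Prop. VII.3.1(b)] -/
theorem exists_order_four_of_all_torsRowCheck {L : List (Rank3Row × TorsCert)}
    (h : L.all torsRowCheck = true) :
    ∀ p ∈ L, p.2.kind = 4 →
      ∃ τ : p.1.curve.toAffine.Point, IsOfFinAddOrder τ ∧ 2 • τ ≠ 0 := by
  intro p hp hk
  rw [Rank3Row.curve_eq_map_intModel]
  exact exists_torsion_two_nsmul_ne_of_check _ _ hk (List.all_eq_true.mp h p hp)


/-! ### Sliced-check plumbing

The census data files pair the tree's row lists `rank3RowsNN` with certificate lists by `List.zip`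
and check SLICES `((rank3RowsNN.drop K).zip slice).all torsRowCheck` in the kernel (one `decide` per
slice, elaborated in parallel); the lemmas below reassemble the slices and turn a checked pairing into
the per-row torsion theorems and the `map` identity used by the histogram. -/

section Plumbing

variable {α β : Type*}

/-- `zip` against an appended right list splits at the length of the first part. [folklore] -/
theorem zip_append_right_eq : ∀ (M : List α) (C R : List β), C.length ≤ M.length →
    M.zip (C ++ R) = M.zip C ++ (M.drop C.length).zip R
  | M, [], R, _ => by simp
  | [], c :: C, R, h => by simp at h
  | m :: M, c :: C, R, h => by
      have h' : C.length ≤ M.length := by simpa using h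
      simp [zip_append_right_eq M C R h']

/-- SLICE STEP: a checked slice at offset `K` of length `n` and a checked remainder at offset `K + n`
give the checked pairing at offset `K`. [folklore] -/
theorem all_zip_step (f : α × β → Bool) (L : List α) (K n : ℕ) {C R : List β}
    (hC : C.length = n) (hL : K + n ≤ L.length)
    (h₁ : ((L.drop K).zip C).all f = true) (h₂ : ((L.drop (K + n)).zip R).all f = true) :
    ((L.drop K).zip (C ++ R)).all f = true := by
  have hlen : C.length ≤ (L.drop K).length := by simp [hC]; omega
  rw [zip_append_right_eq _ _ _ hlen, List.all_append, h₁, hC, List.drop_drop, h₂]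
  rfl

/-- SLICE START: offset `0`. [folklore] -/
theorem all_zip_of_drop_zero (f : α × β → Bool) (L : List α) {C : List β}
    (h : ((L.drop 0).zip C).all f = true) : (L.zip C).all f = true := by
  simpa using h

/-- A CHECKED PAIRING of a row list with a certificate list (Boolean): every pair checks and the
lengths agree (so the pairing covers every row). [folklore] -/
def zipAllB (f : α × β → Bool) (L : List α) (C : List β) : Bool :=
  (L.zip C).all f && (C.length == L.length)

/-- Unfolding of `zipAllB`. [folklore] -/
theorem zipAllB_iff {f : α × β → Bool} {L : List α} {C : List β} :
    zipAllB f L C = true ↔ (L.zip C).all f = true ∧ C.length = L.length := by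
  simp [zipAllB]

/-- Constructor for a checked pairing. [folklore] -/
theorem zipAllB_intro {f : α × β → Bool} {L : List α} {C : List β}
    (h₁ : (L.zip C).all f = true) (h₂ : C.length = L.length) : zipAllB f L C = true :=
  zipAllB_iff.mpr ⟨h₁, h₂⟩

/-- Checked pairings concatenate. [folklore] -/
theorem zipAllB_append {f : α × β → Bool} {L₁ L₂ : List α} {C₁ C₂ : List β}
    (h₁ : zipAllB f L₁ C₁ = true) (h₂ : zipAllB f L₂ C₂ = true) :
    zipAllB f (L₁ ++ L₂) (C₁ ++ C₂) = true := by
  rw [zipAllB_iff] at h₁ h₂ ⊢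
  refine ⟨?_, by simp [h₁.2, h₂.2]⟩
  rw [List.zip_append h₁.2.symm, List.all_append, h₁.1, h₂.1]
  rfl

/-- In a checked pairing the first components are exactly the rows. [folklore] -/
theorem map_fst_of_zipAllB {f : α × β → Bool} {L : List α} {C : List β} (h : zipAllB f L C = true) :
    (L.zip C).map Prod.fst = L :=
  List.map_fst_zip (le_of_eq (zipAllB_iff.mp h).2.symm)

/-- In a checked pairing the second components are exactly the certificates. [folklore] -/
theorem map_snd_of_zipAllB {f : α × β → Bool} {L : List α} {C : List β} (h : zipAllB f L C = true) :
    (L.zip C).map Prod.snd = C :=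
  List.map_snd_zip (le_of_eq (zipAllB_iff.mp h).2)

end Plumbing

/-- **CHECKED PAIRING ⇒ TORSION ORDERS**: every row's curve has the torsion order recorded by its
certificate. HONEST FRAMING: per-curve certified theorems and census instruments; no claim on BSD in
rank ≥ 2. [cite: SilvermanAEC2009, Prop. VII.3.1(b)] [cite: CremonaAlgorithms1997, §3.3] -/
theorem torsionOrder_of_zipAllB {L : List Rank3Row} {C : List TorsCert}
    (h : zipAllB torsRowCheck L C = true) :
    ∀ p ∈ L.zip C, p.1.curve.torsionOrder = p.2.order :=
  torsionOrder_of_all_torsRowCheck (zipAllB_iff.mp h).1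

/-- **CHECKED PAIRING ⇒ THE LIST OF TORSION ORDERS** of the rows is the list of certificate orders
(the identity behind the census histogram). [cite: SilvermanAEC2009, Prop. VII.3.1(b)] -/
theorem map_torsionOrder_of_zipAllB {L : List Rank3Row} {C : List TorsCert}
    (h : zipAllB torsRowCheck L C = true) :
    L.map (fun r => r.curve.torsionOrder) = C.map TorsCert.order := by
  conv_lhs => rw [← map_fst_of_zipAllB h]
  conv_rhs => rw [← map_snd_of_zipAllB h]
  rw [List.map_map, List.map_map]
  exact List.map_congr_left fun p hp => torsionOrder_of_zipAllB h p hp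

/-- Exponent-`2` rows of a checked pairing. [cite: SilvermanAEC2009, Prop. VII.3.1(b)] -/
theorem two_nsmul_torsion_of_zipAllB {L : List Rank3Row} {C : List TorsCert}
    (h : zipAllB torsRowCheck L C = true) :
    ∀ p ∈ L.zip C, (p.2.kind = 2 ∨ p.2.kind = 22) →
      ∀ τ : p.1.curve.toAffine.Point, IsOfFinAddOrder τ → 2 • τ = 0 :=
  two_nsmul_torsion_of_all_torsRowCheck (zipAllB_iff.mp h).1

/-- Order-`4`-element rows of a checked pairing. [cite: SilvermanAEC2009, Prop. VII.3.1(b)] -/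
theorem exists_order_four_of_zipAllB {L : List Rank3Row} {C : List TorsCert}
    (h : zipAllB torsRowCheck L C = true) :
    ∀ p ∈ L.zip C, p.2.kind = 4 →
      ∃ τ : p.1.curve.toAffine.Point, IsOfFinAddOrder τ ∧ 2 • τ ≠ 0 :=
  exists_order_four_of_all_torsRowCheck (zipAllB_iff.mp h).1


end Summit.BirchSwinnertonDyer.BirchSwinnertonDyer.Rank2Observatory
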